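import Literature.NumberTheory.LFunctions.VinogradovZetaSumBound
import HarnessLib

/-!
# The saving at a good index for the line sums over `ℤ[i]`, and counting good indices by parity

Topic `Literature/NumberTheory/LFunctions`.  Everything in this file is PROVED; no definitions, no named facts.
Two auxiliary results for the `ℚ(i)`-analogue of Vinogradov's estimate (Ivić, *The Riemann Zeta-Function*, Theorem 6.2)
along the lines `Im z = b` of the lattice (`GaussianLineSumVinogradov.lean`):

* `log_geomSum_le_of_coeff_bounds` — **the saving at a good index** (the analogue of
  `VinogradovZetaSum.log_sum_geomBound_good_le`, Ivić pp. 122–123): if a real coefficient `α` satisfies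
  `(3/10)τ/(2πp(2N)^p) ≤ |α| ≤ τ/(2πpN^p)` (`N = e^ℓ`, `τ = e^{Yℓ}`, `0.52p ≥ Y + 0.06`, `p ≤ 20Y`, `Y ≥ 0.12`),
  `e^{0.48ℓ}/2 ≤ a ≤ e^{0.48ℓ}`, `log(3k) ≤ ℓ/100` and `ℓ` is large, then
  `log ∑_{|μ| ≤ ka^p} min(2ka^p+1, 1/(2‖αμ‖)) ≤ 2 log(2ka^p + 1) − 0.15 Y ℓ`
  (Ivić's Lemma 6.5 in the no-wrap-around regime, `VinogradovZetaSum.sum_geomBound_le_of_good`);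
* `card_le_two_mul_card_filter_add_one` — **parity count**: if among any two consecutive integers of `[p₁, p₁ + n)`
  at least one satisfies `P`, then `n ≤ 2·#{p ∈ [p₁, p₁+n) : P p} + 1`.

## References

* A. Ivić, *The Riemann Zeta-Function*, John Wiley & Sons 1985 (Dover 2003), §6.3, proof of Theorem 6.2, Lemma 6.5.
  [cite: Ivic1985, Theorem 6.2 (proof)]
-/

noncomputable section

open Finset Real

namespace Literature.NumberTheory.LFunctions

namespace GaussLine

open Sieve.Vinogradov (geomBound geomBound_nonneg geomBound_le)
open VinogradovZetaSum

/-! ### Counting good indices by parity -/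

/-- **Parity count.**  If for every `p` with `p₁ ≤ p` and `p + 1 < p₁ + n` one of `P p`, `P (p+1)` holds, then
`n ≤ 2 · #{p ∈ [p₁, p₁ + n) : P p} + 1`. [folklore] -/
theorem card_le_two_mul_card_filter_add_one (P : ℕ → Prop) [DecidablePred P] :
    ∀ (n p₁ : ℕ), (∀ p, p₁ ≤ p → p + 1 < p₁ + n → P p ∨ P (p + 1)) →
      n ≤ 2 * ((Ico p₁ (p₁ + n)).filter P).card + 1 := by
  intro n
  induction n using Nat.strong_induction_on with
  | _ n ih =>
    intro p₁ hP
    rcases Nat.lt_or_ge n 2 with hn | hn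
    · omega
    · -- split off the first pair `{p₁, p₁ + 1}`
      obtain ⟨n', rfl⟩ : ∃ n', n = n' + 2 := ⟨n - 2, by omega⟩
      have hsplit : Ico p₁ (p₁ + (n' + 2)) = Ico p₁ (p₁ + 2) ∪ Ico (p₁ + 2) (p₁ + 2 + n') := by
        rw [show p₁ + (n' + 2) = p₁ + 2 + n' by ring]
        exact (Ico_union_Ico_eq_Ico (by omega) (by omega)).symm
      have hdisj : Disjoint (Ico p₁ (p₁ + 2)) (Ico (p₁ + 2) (p₁ + 2 + n')) :=
        Ico_disjoint_Ico_consecutive _ _ _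
      rw [hsplit, filter_union, card_union_of_disjoint (disjoint_filter_filter hdisj)]
      -- the first pair contributes at least one
      have hpair : 1 ≤ ((Ico p₁ (p₁ + 2)).filter P).card := by
        rcases hP p₁ le_rfl (by omega) with h | h
        · exact card_pos.mpr ⟨p₁, by rw [mem_filter, mem_Ico]; exact ⟨⟨le_rfl, by omega⟩, h⟩⟩
        · exact card_pos.mpr ⟨p₁ + 1, by rw [mem_filter, mem_Ico]; exact ⟨⟨by omega, by omega⟩, h⟩⟩
      -- the rest by induction
      have hrest := ih n' (by omega) (p₁ + 2) (fun p hp1 hp2 ↦ hP p (by omega) (by omega))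
      omega

/-! ### The saving at a good index -/

set_option maxHeartbeats 2000000 in
/-- **The saving at a good index for the line sums** (the analogue of Ivić pp. 122–123 with the coefficient
`α_p(z) = ±Im(w z^{-p})/(2πp)` in place of `(−1)^p t/(2πp n^p)`).  Let `ℓ ≥ 4000` with `log ℓ + 64 ≤ 0.003ℓ`,
`0.12 ≤ Y`, `log τ = Yℓ`, `p ≥ 1` an integer with `Y + 0.06 ≤ 0.52p` and `p ≤ 20Y`, `e^{0.48ℓ}/2 ≤ a ≤ e^{0.48ℓ}`,
`k ≥ 1` with `log(3k) ≤ ℓ/100`, and let the real number `α` satisfy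
`(3/10)·τ/(2πp·2^p e^{pℓ}) ≤ |α| ≤ τ/(2πp e^{pℓ})`.  Then
`log ∑_{|μ| ≤ ka^p} min(2ka^p + 1, 1/(2‖αμ‖)) ≤ 2 log(2ka^p + 1) − 0.15 Yℓ`
(Lemma 6.5 at `α = ±1/Q`, `Q = 1/|α| ∈ [2πp e^{(p−Y)ℓ}, (20πp/3) 2^p e^{(p−Y)ℓ}]`: the sum is `≤ 24Q(1 + log(Q+1))`, and
`2 log(2ka^p+1) − log(24Q(1+log(Q+1))) ≥ (Y − 0.04p)ℓ − 4.7p − 64 − log ℓ ≥ 0.15Yℓ`).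
[cite: Ivic1985, Theorem 6.2 (proof)] -/
theorem log_geomSum_le_of_coeff_bounds {ℓ Y τ α : ℝ} {p a k : ℕ}
    (c1 : 4000 ≤ ℓ) (c2 : Real.log ℓ + 64 ≤ 0.003 * ℓ) (hY : 0.12 ≤ Y) (hτ : Real.log τ = Y * ℓ) (hτ0 : 0 < τ)
    (hp1 : 1 ≤ p) (hp : Y + 0.06 ≤ 0.52 * p) (hp20 : (p : ℝ) ≤ 20 * Y)
    (ha_half : Real.exp (0.48 * ℓ) / 2 ≤ a) (hax : (a : ℝ) ≤ Real.exp (0.48 * ℓ))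
    (hk1 : 1 ≤ k) (hk : Real.log (3 * k) ≤ ℓ / 100)
    (hαlo : 3 / 10 * (τ / (2 * π * p * (2 ^ p * Real.exp (p * ℓ)))) ≤ |α|)
    (hαhi : |α| ≤ τ / (2 * π * p * Real.exp (p * ℓ))) :
    Real.log (∑ μ ∈ Finset.Icc (-((k : ℤ) * (a : ℤ) ^ p)) ((k : ℤ) * (a : ℤ) ^ p),
        geomBound (2 * k * (a : ℝ) ^ p + 1) (α * μ)) ≤
      2 * Real.log (2 * k * (a : ℝ) ^ p + 1) - 0.15 * Y * ℓ := by
  -- ### basic positivity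
  have hℓ0 : 0 < ℓ := by linarith
  have hY0 : 0 < Y := by linarith
  have hp1r : (1 : ℝ) ≤ p := by exact_mod_cast hp1
  have hp0 : (0 : ℝ) < p := by linarith
  have hk1' : (1 : ℝ) ≤ k := by exact_mod_cast hk1
  have hπ3 : 3 < π := Real.pi_gt_three
  have hπ4 : π < 3.15 := Real.pi_lt_d2
  have hτexp : τ = Real.exp (Y * ℓ) := by rw [← hτ, Real.exp_log hτ0]
  -- `a ≥ e^{0.48ℓ - 1} ≥ 1`
  have ha_low : Real.exp (0.48 * ℓ - 1) ≤ a := by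
    calc Real.exp (0.48 * ℓ - 1) = Real.exp (0.48 * ℓ) * Real.exp (-1) := by rw [← Real.exp_add]; ring_nf
      _ ≤ Real.exp (0.48 * ℓ) * (1 / 2) := by gcongr; exact exp_neg_one_le_half
      _ = Real.exp (0.48 * ℓ) / 2 := by ring
      _ ≤ a := ha_half
  have ha1 : (1 : ℝ) ≤ a := le_trans (Real.one_le_exp (by linarith)) ha_low
  have ha0 : (0 : ℝ) < a := by linarith
  -- ### `Q = 1/|α|`, `α = s/Q`
  have hαpos : 0 < |α| := lt_of_lt_of_le (by positivity) hαlo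
  have hα0 : α ≠ 0 := abs_pos.mp hαpos
  set Q : ℝ := 1 / |α| with hQ
  have hQ0 : 0 < Q := by rw [hQ]; positivity
  have hQα : |α| = 1 / Q := by rw [hQ, one_div_one_div]
  obtain ⟨s, hs, hcoef⟩ : ∃ s : ℤ, (s = 1 ∨ s = -1) ∧ α = (s : ℝ) / Q := by
    rcases lt_or_gt_of_ne hα0 with h | h
    · refine ⟨-1, Or.inr rfl, ?_⟩
      have : |α| = -α := abs_of_neg h
      push_cast; rw [neg_div, ← hQα, this, neg_neg]
    · refine ⟨1, Or.inl rfl, ?_⟩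
      have : |α| = α := abs_of_pos h
      push_cast; rw [← hQα, this]
  -- ### the size of `Q`: `2πp e^{(p-Y)ℓ} ≤ Q ≤ (20πp/3)·2^p·e^{(p-Y)ℓ}`
  have hE : Real.exp (p * ℓ) / τ = Real.exp ((p - Y) * ℓ) := by
    rw [hτexp, ← Real.exp_sub]; ring_nf
  have hpY : 0.54 ≤ (p : ℝ) - Y := by nlinarith
  have hEge1 : 1 ≤ Real.exp ((p - Y) * ℓ) := Real.one_le_exp (by nlinarith)
  have hQlo : 2 * π * p * Real.exp ((p - Y) * ℓ) ≤ Q := by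
    rw [hQ, ← hE]
    have h1 : 0 < τ / (2 * π * p * Real.exp (p * ℓ)) := by positivity
    calc 2 * π * p * (Real.exp (p * ℓ) / τ) = 1 / (τ / (2 * π * p * Real.exp (p * ℓ))) := by
          field_simp
      _ ≤ 1 / |α| := one_div_le_one_div_of_le hαpos hαhi
  have hQhi : Q ≤ 20 * π * p / 3 * 2 ^ p * Real.exp ((p - Y) * ℓ) := by
    rw [hQ, ← hE]
    have h1 : 0 < 3 / 10 * (τ / (2 * π * p * (2 ^ p * Real.exp (p * ℓ)))) := by positivity
    calc 1 / |α| ≤ 1 / (3 / 10 * (τ / (2 * π * p * (2 ^ p * Real.exp (p * ℓ))))) :=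
          one_div_le_one_div_of_le h1 hαlo
      _ = 20 * π * p / 3 * 2 ^ p * (Real.exp (p * ℓ) / τ) := by field_simp; ring
  have hQ2 : 2 ≤ Q := by
    have : 2 * π * (p : ℝ) * 1 ≤ 2 * π * p * Real.exp ((p - Y) * ℓ) := by gcongr
    nlinarith
  -- ### the floor condition `2ka^p + 1 ≤ ⌊Q⌋`
  have h3k : 3 * (k : ℝ) ≤ Real.exp (ℓ / 100) := by
    have h0 : 0 < 3 * (k : ℝ) := by positivity
    calc 3 * (k : ℝ) = Real.exp (Real.log (3 * k)) := (Real.exp_log h0).symm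
      _ ≤ Real.exp (ℓ / 100) := Real.exp_le_exp.mpr hk
  have hap : (a : ℝ) ^ p ≤ Real.exp (0.48 * p * ℓ) := by
    calc (a : ℝ) ^ p ≤ (Real.exp (0.48 * ℓ)) ^ p := pow_le_pow_left₀ ha0.le hax _
      _ = Real.exp (0.48 * p * ℓ) := by rw [← Real.exp_nat_mul]; ring_nf
  have hfloor : 2 * k * (a : ℝ) ^ p + 1 ≤ ⌊Q⌋₊ := by
    have hfl : Q - 1 ≤ ⌊Q⌋₊ := (Nat.sub_one_lt_floor Q).le
    have hkam1 : (1 : ℝ) ≤ k * (a : ℝ) ^ p := one_le_mul_of_one_le_of_one_le hk1' (one_le_pow₀ ha1)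
    calc 2 * k * (a : ℝ) ^ p + 1 ≤ 3 * k * (a : ℝ) ^ p := by linarith
      _ ≤ Real.exp (ℓ / 100) * Real.exp (0.48 * p * ℓ) :=
          mul_le_mul h3k hap (by positivity) (by positivity)
      _ = Real.exp ((1 / 100 + 0.48 * p) * ℓ) := by rw [← Real.exp_add]; ring_nf
      _ ≤ Real.exp ((p - Y) * ℓ) := by
          rw [Real.exp_le_exp]
          have : 1 / 100 + 0.48 * (p : ℝ) ≤ p - Y := by nlinarith
          nlinarith
      _ ≤ Q / 2 := by
          have : 2 * Real.exp ((p - Y) * ℓ) ≤ 2 * π * p * Real.exp ((p - Y) * ℓ) := by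
            have h1 : (2 : ℝ) ≤ 2 * π * p := by nlinarith
            exact mul_le_mul_of_nonneg_right h1 (by positivity)
          linarith
      _ ≤ Q - 1 := by linarith
      _ ≤ ⌊Q⌋₊ := hfl
  -- ### Lemma 6.5 at this index
  have hG := sum_geomBound_le_of_good k a p hQ2 hfloor hs
  simp_rw [hcoef]
  -- positivity of the sum (the term `μ = 0` is `L = 2ka^p + 1`)
  set L : ℝ := 2 * k * (a : ℝ) ^ p + 1 with hL
  have hL1 : 1 ≤ L := by rw [hL]; linarith [show (0 : ℝ) ≤ 2 * k * (a : ℝ) ^ p by positivity]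
  have hSpos : 0 < ∑ μ ∈ Finset.Icc (-((k : ℤ) * (a : ℤ) ^ p)) ((k : ℤ) * (a : ℤ) ^ p),
      geomBound L ((s : ℝ) / Q * μ) := by
    have hmem : (0 : ℤ) ∈ Finset.Icc (-((k : ℤ) * (a : ℤ) ^ p)) ((k : ℤ) * (a : ℤ) ^ p) := by
      have h1 : (0 : ℤ) ≤ (k : ℤ) * (a : ℤ) ^ p :=
        mul_nonneg (Int.natCast_nonneg k) (pow_nonneg (Int.natCast_nonneg a) p)
      rw [Finset.mem_Icc]; constructor <;> linarith
    have h0 : geomBound L ((s : ℝ) / Q * ((0 : ℤ) : ℝ)) = L := by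
      rw [Int.cast_zero, mul_zero, Sieve.Vinogradov.geomBound_zero]
    have h1 := Finset.single_le_sum (f := fun μ : ℤ => geomBound L ((s : ℝ) / Q * μ))
      (fun μ _ => geomBound_nonneg (by linarith) _) hmem
    rw [h0] at h1
    exact lt_of_lt_of_le (zero_lt_one.trans_le hL1) h1
  -- `log G ≤ log 24 + log Q + log(1 + log(Q+1))`
  have hlogQ1 : 0 < 1 + Real.log (Q + 1) := by
    have := Real.log_nonneg (by linarith : 1 ≤ Q + 1); linarith
  have hlogG : Real.log (∑ μ ∈ Finset.Icc (-((k : ℤ) * (a : ℤ) ^ p)) ((k : ℤ) * (a : ℤ) ^ p),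
      geomBound L ((s : ℝ) / Q * μ)) ≤ Real.log 24 + Real.log Q + Real.log (1 + Real.log (Q + 1)) := by
    rw [← Real.log_mul (by norm_num) hQ0.ne', ← Real.log_mul (by positivity) hlogQ1.ne']
    exact Real.log_le_log hSpos hG
  -- ### `log Q ≤ 19 + 1.7p + pℓ − Yℓ`
  have hlogQ : Real.log Q ≤ 19 + 1.7 * p + p * ℓ - Y * ℓ := by
    have h1 : Real.log Q ≤ Real.log (20 * π * p / 3 * 2 ^ p * Real.exp ((p - Y) * ℓ)) := Real.log_le_log hQ0 hQhi
    have h2 : Real.log (20 * π * p / 3 * 2 ^ p * Real.exp ((p - Y) * ℓ)) =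
        Real.log (20 * π / 3) + Real.log p + p * Real.log 2 + (p - Y) * ℓ := by
      rw [Real.log_mul (by positivity) (Real.exp_pos _).ne', Real.log_exp, Real.log_mul (by positivity) (by positivity),
        Real.log_pow, show (20 : ℝ) * π * p / 3 = 20 * π / 3 * p by ring, Real.log_mul (by positivity) hp0.ne']
    have hl1 : Real.log (20 * π / 3) ≤ 20 := by have := log_le_pred (show (0:ℝ) < 20 * π / 3 by positivity); nlinarith
    have hl2 : Real.log p ≤ (p : ℝ) - 1 := log_le_pred hp0
    have hl3 : Real.log 2 ≤ 0.7 := by have := Real.log_two_lt_d9; linarith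
    have hl3' : (p : ℝ) * Real.log 2 ≤ p * 0.7 := mul_le_mul_of_nonneg_left hl3 hp0.le
    rw [h2] at h1
    nlinarith
  -- ### `log(1 + log(Q+1)) ≤ 22 + p + log ℓ`
  have hloglog : Real.log (1 + Real.log (Q + 1)) ≤ 22 + p + Real.log ℓ := by
    have h1 : Real.log (Q + 1) ≤ Real.log (2 * Q) := Real.log_le_log (by linarith) (by linarith)
    rw [Real.log_mul two_ne_zero hQ0.ne'] at h1
    have hlog2 : Real.log 2 ≤ 1 := by have := Real.log_two_lt_d9; linarith
    have h2 : 1 + Real.log (Q + 1) ≤ 24 * p * ℓ := by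
      have hpℓ : (1 : ℝ) * 1 ≤ p * ℓ := mul_le_mul hp1r (by linarith) zero_le_one hp0.le
      have hYℓ : 0 ≤ Y * ℓ := by positivity
      nlinarith
    calc Real.log (1 + Real.log (Q + 1)) ≤ Real.log (24 * p * ℓ) := Real.log_le_log hlogQ1 h2
      _ = Real.log 24 + Real.log p + Real.log ℓ := by
          rw [Real.log_mul (by positivity) hℓ0.ne', Real.log_mul (by norm_num) hp0.ne']
      _ ≤ 22 + p + Real.log ℓ := by
          have h24 : Real.log 24 ≤ 23 := by have := log_le_pred (show (0 : ℝ) < 24 by norm_num); linarith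
          have hpp : Real.log p ≤ (p : ℝ) - 1 := log_le_pred hp0
          linarith
  -- ### lower bound `2 log L ≥ 0.96 p ℓ − 2p`
  have hlogL : 0.96 * p * ℓ - 2 * p ≤ 2 * Real.log L := by
    have hap_low : Real.exp (p * (0.48 * ℓ - 1)) ≤ (a : ℝ) ^ p := by
      calc Real.exp (p * (0.48 * ℓ - 1)) = (Real.exp (0.48 * ℓ - 1)) ^ p := by
            rw [← Real.exp_nat_mul]
        _ ≤ (a : ℝ) ^ p := pow_le_pow_left₀ (by positivity) ha_low _
    have h2ap : (a : ℝ) ^ p ≤ L := by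
      rw [hL]
      have : 0 ≤ (a : ℝ) ^ p := by positivity
      nlinarith
    have h1 : p * (0.48 * ℓ - 1) ≤ Real.log L := by
      calc (p : ℝ) * (0.48 * ℓ - 1) = Real.log (Real.exp (p * (0.48 * ℓ - 1))) := (Real.log_exp _).symm
        _ ≤ Real.log L := Real.log_le_log (Real.exp_pos _) (hap_low.trans h2ap)
    nlinarith
  -- ### numerics
  have hlog24 : Real.log 24 ≤ 23 := by have := log_le_pred (show (0 : ℝ) < 24 by norm_num); linarith
  have hpℓ : (p : ℝ) * ℓ ≤ 20 * Y * ℓ := by nlinarith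
  have h1 : 0.025 * Y * ℓ ≥ 94 * Y := by nlinarith
  have h2 : 0.025 * Y * ℓ ≥ 64 + Real.log ℓ := by nlinarith
  linarith [hlogG, hlogQ, hloglog, hlogL]

end GaussLine

end Literature.NumberTheory.LFunctions
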